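import Literature.NumberTheory.EllipticCurves.ModularSymbolsCoefficients
import HarnessLib

/-!
# Manin's lemma: modular symbols are determined by their values on unimodular pairs of cusps

For the abstract modular symbols of `ModularSymbolsCoefficients` (`φ : ℙ¹(ℚ) → ℙ¹(ℚ) → V` additive,
`Symb A Γ` the `Γ`-invariants) we prove the generation half of Manin's theorem (Manin 1972, §1.5–1.6;
Pollack–Stevens 2011, §2.2): **every divisor `{y} − {x}` is a sum of unimodular divisors
`{g·0} − {g·∞}`, `g ∈ SL₂(ℤ)`** — in the form

* `modSym_eq_zero_of_forall_unimodular`: an additive `φ` vanishing on all unimodular pairs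
  `(g·∞, g·0)` vanishes identically (proof: `φ(∞, a/c)` by strong induction on the denominator `c`,
  peeling off the unimodular step `(b/d, a/c)` with `ad − bc = 1`, `0 ≤ d < c` — the Euclidean algorithm /
  continued fraction expansion of `a/c`);
* `modSym_eq_of_forall_unimodular`: two additive `φ, ψ` agreeing on unimodular pairs are equal;
* `Symb_apply_mul`: for `φ ∈ Symb A Γ`, `γ ∈ Γ`: `φ(γg·∞, γg·0) = ρ(γ⁻¹) φ(g·∞, g·0)`, so that
* `Symb_eq_of_eq_on_reps`: **two `Γ`-invariant symbols agreeing on a set of representatives of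
  `Γ \ SL₂(ℤ)` are equal** — `Symb_Γ(V) ↪ V^{Γ\SL₂(ℤ)}` (Manin symbols), the finiteness statement every
  control / compactness argument for `U_p` on `Symb_Γ` starts from (Greenberg 2007, Lemma 8;
  Eigenbook Lemma 6.5.2).

Also: the classification of points of `ℙ¹(ℚ)` (`P1Q.infty_or_ofRat`, `P1Q.mk_eq_ofRat`, `P1Q.mk_eq_infty`)
and the action of integer matrices on `∞` and `0` (`P1Q.act_mk`, `P1Q.act_infty`, `P1Q.act_ofRat_zero`).

Brick B3e-M of the bottom-up plan recorded with the named fact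
`greenbergStevens_kitagawa_twoVariable_interpolation_allBranches`.  Everything is proved; no named facts.

## References

* Ju. I. Manin, *Parabolic points and zeta functions of modular curves*, Izv. 36 (1972), §1.5–1.6.
  [Manin1972]
* R. Pollack, G. Stevens, Ann. Sci. ÉNS 44 (2011), §2.2. [PollackStevens2011]
-/

noncomputable section

open scoped MatrixGroups
open Matrix

namespace Literature.NumberTheory.EllipticCurves

/-! ### Points of `ℙ¹(ℚ)` and the action on `∞`, `0` -/

namespace P1Q

/-- A vector with non-zero second coordinate gives the finite point `v₀/v₁`. [folklore] -/
theorem mk_eq_ofRat {v : Fin 2 → ℚ} (hv : v ≠ 0) (h1 : v 1 ≠ 0) :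
    Projectivization.mk ℚ v hv = ofRat (v 0 / v 1) := by
  rw [ofRat, Projectivization.mk_eq_mk_iff']
  refine ⟨v 1, ?_⟩
  funext i
  fin_cases i
  · simp [mul_div_cancel₀ _ h1]
  · simp

/-- A vector with zero second coordinate gives `∞`. [folklore] -/
theorem mk_eq_infty {v : Fin 2 → ℚ} (hv : v ≠ 0) (h1 : v 1 = 0) : Projectivization.mk ℚ v hv = infty := by
  have h0 : v 0 ≠ 0 := by
    intro h0
    apply hv
    funext i
    fin_cases i
    · exact h0
    · exact h1
  rw [infty, Projectivization.mk_eq_mk_iff']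
  refine ⟨v 0, ?_⟩
  funext i
  fin_cases i
  · simp
  · simp [h1]

/-- **Every point of `ℙ¹(ℚ)` is `∞` or a rational number.** [folklore] -/
theorem infty_or_ofRat (x : P1Q) : x = infty ∨ ∃ r : ℚ, x = ofRat r := by
  induction x using Projectivization.ind with
  | h v hv =>
    by_cases h1 : v 1 = 0
    · exact Or.inl (mk_eq_infty hv h1)
    · exact Or.inr ⟨v 0 / v 1, mk_eq_ofRat hv h1⟩

/-- Every rational point is `a/c` with `a, c` coprime integers, `c ≥ 1`. [folklore] -/
theorem exists_coprime_eq_ofRat (r : ℚ) :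
    ∃ (a : ℤ) (c : ℕ), 1 ≤ c ∧ IsCoprime a (c : ℤ) ∧ ofRat r = ofRat ((a : ℚ) / (c : ℚ)) := by
  refine ⟨r.num, r.den, r.den_pos, ?_, by rw [Rat.num_div_den]⟩
  rw [Int.isCoprime_iff_gcd_eq_one]
  exact r.reduced

/-- The action of an integer matrix of non-zero determinant on a point `[v]`. [folklore] -/
theorem act_mk {g : Matrix (Fin 2) (Fin 2) ℤ} (hg : g.det ≠ 0) (v : Fin 2 → ℚ) (hv : v ≠ 0) :
    act g (Projectivization.mk ℚ v hv) =
      Projectivization.mk ℚ (ratMat g *ᵥ v) (fun h => hv (toLin'_injective_of_det_ne_zero (det_ratMat_ne_zero hg)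
        (by rw [Matrix.toLin'_apply, h, map_zero]))) := by
  rw [act_eq g (det_ratMat_ne_zero hg), Projectivization.map_mk]
  congr 1

/-- `g·∞ = [a : c]` for `g = (a b; c d)`. [folklore] -/
theorem act_infty {g : Matrix (Fin 2) (Fin 2) ℤ} (hg : g.det ≠ 0) :
    ∃ h : (![(g 0 0 : ℚ), (g 1 0 : ℚ)] : Fin 2 → ℚ) ≠ 0, act g infty = Projectivization.mk ℚ ![(g 0 0 : ℚ), (g 1 0 : ℚ)] h := by
  have hv : ratMat g *ᵥ ![1, 0] = ![(g 0 0 : ℚ), (g 1 0 : ℚ)] := by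
    funext i
    fin_cases i <;> simp [Matrix.mulVec, dotProduct, Fin.sum_univ_two]
  refine ⟨?_, ?_⟩
  · rw [← hv]
    intro h
    have : (![1, 0] : Fin 2 → ℚ) = 0 := toLin'_injective_of_det_ne_zero (det_ratMat_ne_zero hg)
      (by rw [Matrix.toLin'_apply, h, map_zero])
    exact one_ne_zero (congr_fun this 0)
  · rw [infty, act_mk hg]
    congr 1

/-- `g·0 = [b : d]` for `g = (a b; c d)`. [folklore] -/
theorem act_ofRat_zero {g : Matrix (Fin 2) (Fin 2) ℤ} (hg : g.det ≠ 0) :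
    ∃ h : (![(g 0 1 : ℚ), (g 1 1 : ℚ)] : Fin 2 → ℚ) ≠ 0, act g (ofRat 0) = Projectivization.mk ℚ ![(g 0 1 : ℚ), (g 1 1 : ℚ)] h := by
  have hv : ratMat g *ᵥ ![0, 1] = ![(g 0 1 : ℚ), (g 1 1 : ℚ)] := by
    funext i
    fin_cases i <;> simp [Matrix.mulVec, dotProduct, Fin.sum_univ_two]
  refine ⟨?_, ?_⟩
  · rw [← hv]
    intro h
    have : (![0, 1] : Fin 2 → ℚ) = 0 := toLin'_injective_of_det_ne_zero (det_ratMat_ne_zero hg)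
      (by rw [Matrix.toLin'_apply, h, map_zero])
    exact one_ne_zero (congr_fun this 1)
  · rw [ofRat, act_mk hg]
    congr 1

/-- The integer matrix `(a b; c d)`. [folklore] -/
def mat2 (a b c d : ℤ) : Matrix (Fin 2) (Fin 2) ℤ := !![a, b; c, d]

/-- Its determinant. [folklore] -/
theorem det_mat2 (a b c d : ℤ) : (mat2 a b c d).det = a * d - b * c := by
  rw [mat2, Matrix.det_fin_two_of]

/-- `(a b; c d)·∞ = a/c` for `c ≠ 0`. [folklore] -/
theorem mat2_act_infty {a b c d : ℤ} (hdet : a * d - b * c ≠ 0) (hc : c ≠ 0) :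
    act (mat2 a b c d) infty = ofRat ((a : ℚ) / (c : ℚ)) := by
  have hg : (mat2 a b c d).det ≠ 0 := by rwa [det_mat2]
  obtain ⟨h, he⟩ := act_infty hg
  rw [he, mk_eq_ofRat h (by simp [mat2]; exact_mod_cast hc)]
  simp [mat2]

/-- `(a b; 0 d)·∞ = ∞`. [folklore] -/
theorem mat2_act_infty_of_eq_zero {a b d : ℤ} (hdet : a * d - b * 0 ≠ 0) :
    act (mat2 a b 0 d) infty = infty := by
  have hg : (mat2 a b 0 d).det ≠ 0 := by rwa [det_mat2]
  obtain ⟨h, he⟩ := act_infty hg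
  rw [he, mk_eq_infty h (by simp [mat2])]

/-- `(a b; c d)·0 = b/d` for `d ≠ 0`. [folklore] -/
theorem mat2_act_zero {a b c d : ℤ} (hdet : a * d - b * c ≠ 0) (hd : d ≠ 0) :
    act (mat2 a b c d) (ofRat 0) = ofRat ((b : ℚ) / (d : ℚ)) := by
  have hg : (mat2 a b c d).det ≠ 0 := by rwa [det_mat2]
  obtain ⟨h, he⟩ := act_ofRat_zero hg
  rw [he, mk_eq_ofRat h (by simp [mat2]; exact_mod_cast hd)]
  simp [mat2]

/-- The `SL₂(ℤ)` element `(a b; c d)` with `ad − bc = 1`. [folklore] -/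
def sl2 (a b c d : ℤ) (h : a * d - b * c = 1) : SL(2, ℤ) := ⟨mat2 a b c d, by rw [det_mat2, h]⟩

/-- Its underlying matrix. [folklore] -/
@[simp] theorem coe_sl2 (a b c d : ℤ) (h : a * d - b * c = 1) : ((sl2 a b c d h : SL(2, ℤ)) : Matrix (Fin 2) (Fin 2) ℤ) = mat2 a b c d :=
  rfl

end P1Q

/-! ### Manin's lemma -/

section Manin

variable {R V : Type*} [CommRing R] [AddCommGroup V] [Module R V]

open P1Q

/-- The Euclidean step: for `a` coprime to `c ≥ 2` there are `b, d` with `ad − bc = 1` and `0 < d < c`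
(and then `b` is coprime to `d`). [folklore] -/
theorem exists_unimodular_step {a : ℤ} {c : ℕ} (hc : 2 ≤ c) (hac : IsCoprime a (c : ℤ)) :
    ∃ (b : ℤ) (d : ℕ), 0 < d ∧ d < c ∧ a * d - b * c = 1 := by
  obtain ⟨u, v, huv⟩ := hac
  have hc0 : (0 : ℤ) < c := by exact_mod_cast (by omega : 0 < c)
  -- `d = u mod c`
  set d : ℤ := u % c with hd
  have hd0 : 0 ≤ d := Int.emod_nonneg _ hc0.ne'
  have hdc : d < c := Int.emod_lt_of_pos _ hc0
  have hdvd : (c : ℤ) ∣ a * d - 1 := by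
    have h1 : a * d - 1 = -(v * c) - a * (c * (u / c)) := by
      have := Int.emod_add_mul_ediv u c  -- u % c + c * (u / c) = u
      rw [hd]
      linear_combination a * this + huv
    rw [h1]
    exact dvd_sub (dvd_neg.mpr (dvd_mul_left _ _)) (dvd_mul_of_dvd_right (dvd_mul_right _ _) _)
  obtain ⟨b, hb⟩ := hdvd
  have hdne : d ≠ 0 := by
    intro h0
    rw [h0, mul_zero, zero_sub] at hb
    have : (c : ℤ) ∣ 1 := ⟨-b, by linear_combination -hb⟩
    have := Int.eq_one_of_dvd_one hc0.le this
    omega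
  refine ⟨b, d.toNat, by omega, by omega, ?_⟩
  rw [Int.toNat_of_nonneg hd0]
  linear_combination hb

/-- **Manin's lemma (vanishing form)**: an additive function of pairs of cusps vanishing on all
unimodular pairs `(g·∞, g·0)`, `g ∈ SL₂(ℤ)`, vanishes identically. [cite: Manin1972, §1.6] -/
theorem modSym_eq_zero_of_forall_unimodular {φ : P1Q → P1Q → V} (hφ : φ ∈ modSym R V)
    (h : ∀ g : SL(2, ℤ), φ (act (g : Matrix (Fin 2) (Fin 2) ℤ) infty) (act (g : Matrix (Fin 2) (Fin 2) ℤ) (ofRat 0)) = 0) :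
    φ = 0 := by
  -- Step 1: `φ(∞, a/c) = 0` for coprime `a, c`, `c ≥ 1`, by strong induction on `c`.
  have key : ∀ (c : ℕ) (a : ℤ), 1 ≤ c → IsCoprime a (c : ℤ) → φ infty (ofRat ((a : ℚ) / (c : ℚ))) = 0 := by
    intro c
    induction c using Nat.strong_induction_on with
    | _ c ih =>
      intro a hc hac
      rcases Nat.lt_or_ge c 2 with hc1 | hc2
      · -- `c = 1`: `(1 a; 0 1)` sends `(∞, 0)` to `(∞, a)`
        have hc1' : c = 1 := by omega
        subst hc1'
        have hg := h (sl2 1 a 0 1 (by ring))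
        rw [coe_sl2, mat2_act_infty_of_eq_zero (by norm_num), mat2_act_zero (by norm_num) one_ne_zero] at hg
        simpa using hg
      · obtain ⟨b, d, hd0, hdc, hdet⟩ := exists_unimodular_step hc2 hac
        have hbd : IsCoprime b (d : ℤ) := ⟨-(c : ℤ), a, by linear_combination hdet⟩
        have ih' := ih d hdc b hd0 hbd
        -- `φ(∞, a/c) = φ(∞, b/d) + φ(b/d, a/c)` and `(b/d, a/c) = (g·0, g·∞)` for `g = (a b; c d)`
        have hg := h (sl2 a b c d hdet)
        have hc0 : (c : ℤ) ≠ 0 := by exact_mod_cast (by omega : c ≠ 0)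
        have hd0' : (d : ℤ) ≠ 0 := by exact_mod_cast hd0.ne'
        rw [coe_sl2, mat2_act_infty (by rw [hdet]; exact one_ne_zero) hc0,
          mat2_act_zero (by rw [hdet]; exact one_ne_zero) hd0'] at hg
        push_cast at hg ih' ⊢
        rw [← (mem_modSym_iff.mp hφ) infty (ofRat ((b : ℚ) / (d : ℚ))) (ofRat ((a : ℚ) / (c : ℚ))), ih', zero_add,
          modSym_swap hφ, hg, neg_zero]
  -- Step 2: `φ(∞, y) = 0` for all `y`, and then `φ(x, y) = φ(x, ∞) + φ(∞, y) = 0`.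
  have hinf : ∀ y, φ infty y = 0 := fun y => by
    rcases infty_or_ofRat y with rfl | ⟨r, rfl⟩
    · exact modSym_self hφ infty
    · obtain ⟨a, c, hc, hac, he⟩ := exists_coprime_eq_ofRat r
      rw [he]
      exact key c a hc hac
  funext x y
  rw [Pi.zero_apply, Pi.zero_apply, ← (mem_modSym_iff.mp hφ) x infty y, hinf y, add_zero, modSym_swap hφ, hinf x, neg_zero]

/-- **Manin's lemma**: additive functions of pairs of cusps agreeing on all unimodular pairs are equal.
[cite: Manin1972, §1.6] -/
theorem modSym_eq_of_forall_unimodular {φ ψ : P1Q → P1Q → V} (hφ : φ ∈ modSym R V) (hψ : ψ ∈ modSym R V)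
    (h : ∀ g : SL(2, ℤ), φ (act (g : Matrix (Fin 2) (Fin 2) ℤ) infty) (act (g : Matrix (Fin 2) (Fin 2) ℤ) (ofRat 0)) =
      ψ (act (g : Matrix (Fin 2) (Fin 2) ℤ) infty) (act (g : Matrix (Fin 2) (Fin 2) ℤ) (ofRat 0))) :
    φ = ψ := by
  rw [← sub_eq_zero]
  refine modSym_eq_zero_of_forall_unimodular (sub_mem hφ hψ) fun g => ?_
  rw [Pi.sub_apply, Pi.sub_apply, h g, sub_self]

end Manin

namespace CoeffActionOn

variable {R V : Type*} [CommRing R] [AddCommGroup V] [Module R V]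
variable {S : Set (Matrix (Fin 2) (Fin 2) ℤ)} (A : CoeffActionOn S R V)

open P1Q

/-- **Values of a `Γ`-invariant symbol on `Γ`-translates**: `φ(γg·∞, γg·0) = ρ(γ⁻¹) φ(g·∞, g·0)` for
`γ ∈ Γ`. [folklore] -/
theorem Symb_apply_mul {Γ : Subgroup SL(2, ℤ)} {φ : P1Q → P1Q → V} (hφ : φ ∈ A.Symb Γ) {γ : SL(2, ℤ)} (hγ : γ ∈ Γ)
    (g : SL(2, ℤ)) (x y : P1Q) :
    φ (act ((γ * g : SL(2, ℤ)) : Matrix (Fin 2) (Fin 2) ℤ) x) (act ((γ * g : SL(2, ℤ)) : Matrix (Fin 2) (Fin 2) ℤ) y) =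
      A.ρ ((γ⁻¹ : SL(2, ℤ)) : Matrix (Fin 2) (Fin 2) ℤ)
        (φ (act (g : Matrix (Fin 2) (Fin 2) ℤ) x) (act (g : Matrix (Fin 2) (Fin 2) ℤ) y)) := by
  have hinv := (A.mem_Symb_iff.mp hφ).2 γ⁻¹ (inv_mem hγ)
  have hdet : ∀ δ : SL(2, ℤ), (δ : Matrix (Fin 2) (Fin 2) ℤ).det ≠ 0 := fun δ => by rw [δ.2]; exact one_ne_zero
  have hm : ((γ⁻¹ : SL(2, ℤ)) : Matrix (Fin 2) (Fin 2) ℤ) * ((γ * g : SL(2, ℤ)) : Matrix (Fin 2) (Fin 2) ℤ) =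
      (g : Matrix (Fin 2) (Fin 2) ℤ) := by
    show ((γ⁻¹ * (γ * g) : SL(2, ℤ)) : Matrix (Fin 2) (Fin 2) ℤ) = _
    rw [inv_mul_cancel_left]
  conv_lhs => rw [← hinv]
  rw [CoeffActionOn.slash_apply, act_act (hdet _) (hdet _), act_act (hdet _) (hdet _), hm]

/-- **Manin: a `Γ`-invariant symbol is determined by its values on representatives of `Γ \ SL₂(ℤ)`**
(`Symb_Γ(V) ↪ V^{Γ\SL₂(ℤ)}`, the Manin symbols). [cite: Manin1972, §1.6] -/
theorem Symb_eq_of_eq_on_reps {Γ : Subgroup SL(2, ℤ)} {ι : Type*} (reps : ι → SL(2, ℤ))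
    (hcover : ∀ g : SL(2, ℤ), ∃ (i : ι) (γ : SL(2, ℤ)), γ ∈ Γ ∧ g = γ * reps i)
    {φ ψ : P1Q → P1Q → V} (hφ : φ ∈ A.Symb Γ) (hψ : ψ ∈ A.Symb Γ)
    (h : ∀ i, φ (act (reps i : Matrix (Fin 2) (Fin 2) ℤ) infty) (act (reps i : Matrix (Fin 2) (Fin 2) ℤ) (ofRat 0)) =
      ψ (act (reps i : Matrix (Fin 2) (Fin 2) ℤ) infty) (act (reps i : Matrix (Fin 2) (Fin 2) ℤ) (ofRat 0))) :
    φ = ψ := by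
  refine modSym_eq_of_forall_unimodular hφ.1 hψ.1 fun g => ?_
  obtain ⟨i, γ, hγ, rfl⟩ := hcover g
  rw [A.Symb_apply_mul hφ hγ, A.Symb_apply_mul hψ hγ, h i]

/-- **The Manin-symbol map `Symb_Γ(V) → V^ι`, `φ ↦ (φ(gᵢ·∞, gᵢ·0))ᵢ`, is injective** for any family
`(gᵢ)` meeting every coset of `Γ \ SL₂(ℤ)`. [cite: Manin1972, §1.6] -/
def maninMap (Γ : Subgroup SL(2, ℤ)) {ι : Type*} (reps : ι → SL(2, ℤ)) : A.Symb Γ →ₗ[R] (ι → V) where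
  toFun φ i := φ.1 (act (reps i : Matrix (Fin 2) (Fin 2) ℤ) infty) (act (reps i : Matrix (Fin 2) (Fin 2) ℤ) (ofRat 0))
  map_add' _ _ := rfl
  map_smul' _ _ := rfl

/-- Unfolding `maninMap`. [folklore] -/
theorem maninMap_apply (Γ : Subgroup SL(2, ℤ)) {ι : Type*} (reps : ι → SL(2, ℤ)) (φ : A.Symb Γ) (i : ι) :
    A.maninMap Γ reps φ i = φ.1 (act (reps i : Matrix (Fin 2) (Fin 2) ℤ) infty) (act (reps i : Matrix (Fin 2) (Fin 2) ℤ) (ofRat 0)) :=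
  rfl

/-- **Injectivity of the Manin-symbol map.** [cite: Manin1972, §1.6] -/
theorem maninMap_injective (Γ : Subgroup SL(2, ℤ)) {ι : Type*} (reps : ι → SL(2, ℤ))
    (hcover : ∀ g : SL(2, ℤ), ∃ (i : ι) (γ : SL(2, ℤ)), γ ∈ Γ ∧ g = γ * reps i) :
    Function.Injective (A.maninMap Γ reps) := fun φ ψ h =>
  Subtype.ext (A.Symb_eq_of_eq_on_reps reps hcover φ.2 ψ.2 fun i => congr_fun h i)

end CoeffActionOn

end Literature.NumberTheory.EllipticCurves

end
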